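import Literature.Topology.FourManifolds.SphereImmersionNormalField
import Literature.Topology.FourManifolds.TwoKnotNormalSection
import Literature.Topology.FourManifolds.OrientationChartSign
import HarnessLib

/-!
# The rotation by a right angle in the oriented normal planes of a codimension-two immersion

Topic `Literature/Topology/FourManifolds`; second file of the generalisation of the tree's
2-knot pipeline (Kirby, *The Topology of 4-Manifolds* (1989), Ch. VIII, Thm. 2: *an oriented
`Mᵐ` smoothly embedded in an oriented `Q^{m+2}` representing `0 ∈ H_m(Q)` has trivial normal
bundle* — "Since the normal bundle is oriented, it is enough to find a non-zero cross-section")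
from the round `S²` (`TwoKnotNormalSection.lean`, the partner field) to an **abstract oriented
manifold** `M` (charted on `ℝⁿ`, with a `Literature.Topology.FourManifolds.SmoothOrientation`)
immersed in the round sphere `f : M → 𝕊ⁿ⁺²`.

For `y : M` and a normal vector `w ∈ ν_y` (`Literature.Topology.FourManifolds.norSpace`, the
`2`-plane `(ℝ f y ⊕ d(ι∘f)_y(T_y M))ᗮ`) the **partner** `J_y w ∈ ν_y` is the unit vector
completing `w` to a positive orthonormal frame of `ν_y`: the normalised `(n+2)`-fold cross product
(tree's `Literature.Topology.FourManifolds.vecCross`) of `f y`, a positive frame of the tangent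
plane and `w` (`rawPartner`, `partner`). Positivity of tangent frames is the tree's
`SmoothOrientation.sign` / `SmoothOrientation.IsPosFrame` bookkeeping (`OrientationSign.lean`),
the frame being the image under `d(ι ∘ f)_y` of the sign-corrected reference basis of the model
space. The definition uses no chart; the main result is that **`(y, w) ↦ J_y w` is continuous on
the set of nonzero normal vectors** (`continuousOn_partner`), proved by reading `d(ι ∘ f)_y` in
the chart at a base point (`NormalRetraction.lean`: `mfderiv_eq_chartDeriv_comp`): the global
and the chart frame differ by `dφ_y`, the cross product is alternating multilinear in the frame
(`crossVec_eq_det_smul`, Mathlib's `AlternatingMap.eq_smul_basis_det`), so the two cross products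
differ by the factor `sign o y · det (dφ_y ∘ b)`, whose sign is the orientation character of the
chart at `y` (tree's `SmoothOrientation.IsPosChart`, `isPosFrame_iff_isPosChart_iff`), constant on
preconnected parts of the chart domain (`isPosChart_iff_of_isPreconnected`).

* § `CrossVec` — `crossFam`, `crossVec a v w = vecCross (a, v₁, …, vₙ, w)`: orthogonality,
  non-vanishing for independent data, smoothness, and the frame-change rule
  `crossVec a (L ∘ c) w = det_b(c) • crossVec a (L ∘ b) w` (`crossVec_eq_det_smul`).
* § `Partner` — `rawPartner`, `partner`; `partner_mem_norSpace`, `inner_partner_self`,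
  `norm_partner`; the local representation `rawPartner_eq_smul_local` and
  **`continuousOn_partner`**.

Everything is proved; no named facts are introduced (D-0026).

## References

* R. C. Kirby, *The Topology of 4-Manifolds*, LNM 1374, Springer (1989), Ch. VIII, Thm. 2 and its
  proof, p. 44. [Kirby1989]
* M. W. Hirsch, *Differential Topology*, GTM 33 (1976), Ch. 4 §4 (orientations; oriented vector
  bundles). [HirschDT1976]
-/

open scoped Manifold ContDiff Topology RealInnerProductSpace
open Set Function Module Filter

noncomputable section

namespace Literature.Topology.FourManifolds

/-- Local notation: `𝔼 n` is the model Euclidean space `EuclideanSpace ℝ (Fin n)`. -/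
local notation "𝔼 " n:arg => EuclideanSpace ℝ (Fin n)

/-- Local notation: `𝕊 n` is the unit sphere in `EuclideanSpace ℝ (Fin (n + 1))`. -/
local notation "𝕊 " n:arg => (Metric.sphere (0 : EuclideanSpace ℝ (Fin (n + 1))) 1)

attribute [local instance] fact_finrank_euclideanSpace_succ

/-! ### The cross product of a position vector, a tangent frame and a normal vector -/

section CrossVec

variable {n : ℕ}

/-- The family `(a, v₁, …, vₙ, w)` of `n + 2` vectors of `ℝⁿ⁺³`. [folklore] -/
def crossFam (a : 𝔼 (n+2+1)) (v : Fin n → 𝔼 (n+2+1)) (w : 𝔼 (n+2+1)) : Fin (n + 2) → 𝔼 (n+2+1) :=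
  Fin.cons a (Fin.snoc v w)

/-- Slot `0` of the family is `a`. [folklore] -/
@[simp] theorem crossFam_zero (a : 𝔼 (n+2+1)) (v : Fin n → 𝔼 (n+2+1)) (w : 𝔼 (n+2+1)) :
    crossFam a v w 0 = a := rfl

/-- The last slot of the family is `w`. [folklore] -/
@[simp] theorem crossFam_last (a : 𝔼 (n+2+1)) (v : Fin n → 𝔼 (n+2+1)) (w : 𝔼 (n+2+1)) :
    crossFam a v w (Fin.last (n + 1)) = w := by
  simp [crossFam]

/-- The middle slots of the family are the `v i`. [folklore] -/
@[simp] theorem crossFam_mid (a : 𝔼 (n+2+1)) (v : Fin n → 𝔼 (n+2+1)) (w : 𝔼 (n+2+1)) (i : Fin n) :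
    crossFam a v w (Fin.castSucc i).succ = v i := by
  simp [crossFam]

/-- Updating a middle vector updates the middle slot (for any decidability instance on `Fin n`,
as needed inside the fields of an alternating map). [folklore] -/
theorem crossFam_update [inst : DecidableEq (Fin n)] (a : 𝔼 (n+2+1)) (v : Fin n → 𝔼 (n+2+1))
    (w : 𝔼 (n+2+1)) (i : Fin n) (p : 𝔼 (n+2+1)) :
    crossFam a (update v i p) w = update (crossFam a v w) (Fin.castSucc i).succ p := by
  have h : inst = instDecidableEqFin n := Subsingleton.elim _ _
  subst h
  rw [crossFam, crossFam, Fin.snoc_update, Fin.cons_update]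

/-- The **cross vector** `crossVec a v w = vecCross (a, v₁, …, vₙ, w) ∈ ℝⁿ⁺³`: orthogonal to all
`n + 2` vectors, nonzero iff they are linearly independent. [folklore] -/
def crossVec (a : 𝔼 (n+2+1)) (v : Fin n → 𝔼 (n+2+1)) (w : 𝔼 (n+2+1)) : 𝔼 (n+2+1) :=
  vecCross (crossFam a v w)

/-- `crossVec a v w ⊥ a`. [folklore] -/
theorem inner_crossVec_left (a : 𝔼 (n+2+1)) (v : Fin n → 𝔼 (n+2+1)) (w : 𝔼 (n+2+1)) :
    ⟪crossVec a v w, a⟫ = 0 := by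
  rw [crossVec]
  simpa using inner_vecCross_self (crossFam a v w) 0

/-- `crossVec a v w ⊥ w`. [folklore] -/
theorem inner_crossVec_right (a : 𝔼 (n+2+1)) (v : Fin n → 𝔼 (n+2+1)) (w : 𝔼 (n+2+1)) :
    ⟪crossVec a v w, w⟫ = 0 := by
  rw [crossVec]
  simpa using inner_vecCross_self (crossFam a v w) (Fin.last (n + 1))

/-- `crossVec a v w ⊥ v i`. [folklore] -/
theorem inner_crossVec_mid (a : 𝔼 (n+2+1)) (v : Fin n → 𝔼 (n+2+1)) (w : 𝔼 (n+2+1)) (i : Fin n) :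
    ⟪crossVec a v w, v i⟫ = 0 := by
  rw [crossVec]
  simpa using inner_vecCross_self (crossFam a v w) (Fin.castSucc i).succ

/-- `crossVec a v w` is orthogonal to the span of the `v i`. [folklore] -/
theorem inner_crossVec_eq_zero_of_mem_span (a : 𝔼 (n+2+1)) (v : Fin n → 𝔼 (n+2+1)) (w : 𝔼 (n+2+1))
    {u : 𝔼 (n+2+1)} (hu : u ∈ Submodule.span ℝ (Set.range v)) : ⟪crossVec a v w, u⟫ = 0 := by
  rw [real_inner_comm]
  refine Submodule.inner_right_of_mem_orthogonal (K := Submodule.span ℝ (Set.range v)) hu ?_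
  rw [Submodule.mem_orthogonal]
  intro z hz
  refine Submodule.span_induction (fun _ ⟨i, hi⟩ => ?_) ?_ (fun x y _ _ hx hy => ?_)
    (fun c x _ hx => ?_) hz
  · rw [← hi, real_inner_comm]; exact inner_crossVec_mid a v w i
  · exact inner_zero_left _
  · rw [inner_add_left, hx, hy, add_zero]
  · rw [real_inner_smul_left, hx, mul_zero]

/-- **Non-vanishing**: for linearly independent data the cross vector is nonzero. [folklore] -/
theorem crossVec_ne_zero {a : 𝔼 (n+2+1)} {v : Fin n → 𝔼 (n+2+1)} {w : 𝔼 (n+2+1)}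
    (h : LinearIndependent ℝ (crossFam a v w)) : crossVec a v w ≠ 0 :=
  vecCross_ne_zero_of_linearIndependent h

/-- The family depends continuously (indeed linearly) on its data. [folklore] -/
theorem continuous_crossFam :
    Continuous fun p : 𝔼 (n+2+1) × (Fin n → 𝔼 (n+2+1)) × 𝔼 (n+2+1) => crossFam p.1 p.2.1 p.2.2 := by
  refine continuous_pi fun k => ?_
  refine Fin.cases ?_ (fun j => ?_) k
  · simpa [crossFam] using continuous_fst
  · refine Fin.lastCases ?_ (fun i => ?_) j
    · have : (fun p : 𝔼 (n+2+1) × (Fin n → 𝔼 (n+2+1)) × 𝔼 (n+2+1) =>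
          crossFam p.1 p.2.1 p.2.2 (Fin.last n).succ) = fun p => p.2.2 := by
        funext p
        exact crossFam_last p.1 p.2.1 p.2.2
      rw [this]
      exact continuous_snd.comp continuous_snd
    · have : (fun p : 𝔼 (n+2+1) × (Fin n → 𝔼 (n+2+1)) × 𝔼 (n+2+1) =>
          crossFam p.1 p.2.1 p.2.2 (Fin.castSucc i).succ) = fun p => p.2.1 i := by
        funext p
        exact crossFam_mid p.1 p.2.1 p.2.2 i
      rw [this]
      exact (continuous_apply i).comp (continuous_fst.comp continuous_snd)

/-- **The cross vector depends continuously on its data.** [folklore] -/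
theorem continuous_crossVec :
    Continuous fun p : 𝔼 (n+2+1) × (Fin n → 𝔼 (n+2+1)) × 𝔼 (n+2+1) => crossVec p.1 p.2.1 p.2.2 :=
  contDiff_vecCross.continuous.comp continuous_crossFam

/-- The cross vector as an **alternating multilinear form in the tangent frame read through a
linear map**: `c ↦ ⟪crossVec a (L ∘ c) w, u⟫`. [folklore] -/
def crossAlt (a w u : 𝔼 (n+2+1)) (L : 𝔼 n →L[ℝ] 𝔼 (n+2+1)) : (𝔼 n) [⋀^Fin n]→ₗ[ℝ] ℝ where
  toFun c := ⟪crossVec a (fun j => L (c j)) w, u⟫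
  map_update_add' c i p q := by
    change ⟪vecCross (crossFam a (fun j => L (update c i (p + q) j)) w), u⟫ =
      ⟪vecCross (crossFam a (fun j => L (update c i p j)) w), u⟫ +
        ⟪vecCross (crossFam a (fun j => L (update c i q j)) w), u⟫
    have h : ∀ r : 𝔼 n, (fun j => L (update c i r j)) = update (fun j => L (c j)) i (L r) := by
      intro r
      funext j
      by_cases hj : j = i
      · subst hj; simp
      · simp [hj]
    rw [h, h, h, crossFam_update, crossFam_update, crossFam_update, map_add, vecCross_update_add,
      inner_add_left]
  map_update_smul' c i r p := by
    change ⟪vecCross (crossFam a (fun j => L (update c i (r • p) j)) w), u⟫ =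
      r • ⟪vecCross (crossFam a (fun j => L (update c i p j)) w), u⟫
    have h : ∀ r : 𝔼 n, (fun j => L (update c i r j)) = update (fun j => L (c j)) i (L r) := by
      intro r
      funext j
      by_cases hj : j = i
      · subst hj; simp
      · simp [hj]
    rw [h, h, crossFam_update, crossFam_update, map_smul, vecCross_update_smul, inner_smul_left]
    simp
  map_eq_zero_of_eq' c i j hij hne := by
    change ⟪vecCross (crossFam a (fun j => L (c j)) w), u⟫ = 0
    have h0 : vecCross (crossFam a (fun j => L (c j)) w) = 0 := by
      refine vecCross_eq_zero_of_eq (i := (Fin.castSucc i).succ) (j := (Fin.castSucc j).succ) ?_ ?_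
      · intro h
        exact hne (Fin.castSucc_injective _ (Fin.succ_injective _ h))
      · rw [crossFam_mid, crossFam_mid, hij]
    rw [h0, inner_zero_left]

/-- Unfolding of `crossAlt`. [folklore] -/
theorem crossAlt_apply (a w u : 𝔼 (n+2+1)) (L : 𝔼 n →L[ℝ] 𝔼 (n+2+1)) (c : Fin n → 𝔼 n) :
    crossAlt a w u L c = ⟪crossVec a (fun j => L (c j)) w, u⟫ := rfl

/-- **Frame-change rule**: reading the tangent frame through a linear map, the cross vector of the
frame `c` is `det_b(c)` times the cross vector of the basis `b`. [folklore] -/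
theorem crossVec_eq_det_smul (a w : 𝔼 (n+2+1)) (L : 𝔼 n →L[ℝ] 𝔼 (n+2+1)) (b : Basis (Fin n) ℝ (𝔼 n))
    (c : Fin n → 𝔼 n) :
    crossVec a (fun j => L (c j)) w = b.det c • crossVec a (fun j => L (b j)) w := by
  refine ext_inner_right ℝ fun u => ?_
  have h := congrArg (fun g : (𝔼 n) [⋀^Fin n]→ₗ[ℝ] ℝ => g c)
    ((crossAlt a w u L).eq_smul_basis_det b)
  simp only [AlternatingMap.smul_apply, smul_eq_mul] at h
  rw [crossAlt_apply, crossAlt_apply] at h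
  rw [h, real_inner_smul_left, mul_comm]

end CrossVec

/-! ### The partner of a normal vector -/

section Partner

variable {n : ℕ} {M : Type*} [TopologicalSpace M] [ChartedSpace (𝔼 n) M] [IsManifold (𝓡 n) ∞ M]
  (o : SmoothOrientation (𝓡 n) M) (f : M → 𝕊 (n + 2))

/-- The reference basis of the model space `ℝⁿ`, indexed by `Fin n` (the reindexing of
`Module.finBasis ℝ ℝⁿ`, the reference basis of `SmoothOrientation.sign`). [folklore] -/
def refBasis (n : ℕ) : Basis (Fin n) ℝ (𝔼 n) :=
  (finBasis ℝ (𝔼 n)).reindex (finCongr finrank_euclideanSpace_fin)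

/-- The reindexed reference basis is the reference basis composed with the index bijection.
[folklore] -/
theorem refBasis_comp (n : ℕ) :
    (⇑(refBasis n) ∘ ⇑(finCongr (finrank_euclideanSpace_fin (𝕜 := ℝ) (n := n)))) =
      ⇑(finBasis ℝ (𝔼 n)) := by
  funext i
  simp [refBasis]

/-- Determinants with respect to the reindexed reference basis are the original ones after
reindexing the frame. [folklore] -/
theorem refBasis_det (n : ℕ) (v : Fin n → 𝔼 n) :
    (refBasis n).det v = (finBasis ℝ (𝔼 n)).det (v ∘ ⇑(finCongr (finrank_euclideanSpace_fin
      (𝕜 := ℝ) (n := n)))) := by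
  rw [refBasis, Basis.det_reindex]

/-- The **raw partner** of `w` at `y`: the cross vector of `f y`, the positive tangent frame
`sign o y · d(ι ∘ f)_y(b)` (`b` the reference basis of the model space) and `w`. For a normal
vector `w ∈ ν_y` it is a vector of `ν_y` orthogonal to `w`, nonzero if `w ≠ 0`; its direction is
the rotation of `w` by a right angle in the normal plane oriented by `o` (Kirby: "`s` rotated by a
right angle"). Its length depends on the chart at `y`; see `partner`. [cite: Kirby1989, Ch. VIII, proof of Thm. 2, p. 44] -/
def rawPartner (y : M) (w : 𝔼 (n+2+1)) : 𝔼 (n+2+1) :=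
  o.sign y • crossVec (f y : 𝔼 (n+2+1)) (fun j => ambientDeriv (𝓡 n) f y (refBasis n j)) w

/-- The **partner** `J_y w` of `w` at `y`: the normalised raw partner (a unit vector, or `0`).
[cite: Kirby1989, Ch. VIII, proof of Thm. 2, p. 44] -/
def partner (y : M) (w : 𝔼 (n+2+1)) : 𝔼 (n+2+1) :=
  ‖rawPartner o f y w‖⁻¹ • rawPartner o f y w

variable {o f}

/-- The raw partner is orthogonal to `f y`. [folklore] -/
theorem inner_rawPartner_coe (y : M) (w : 𝔼 (n+2+1)) :
    ⟪rawPartner o f y w, (f y : 𝔼 (n+2+1))⟫ = 0 := by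
  rw [rawPartner, inner_smul_left, inner_crossVec_left, mul_zero]

/-- The raw partner is orthogonal to `w`. [folklore] -/
theorem inner_rawPartner_self (y : M) (w : 𝔼 (n+2+1)) : ⟪rawPartner o f y w, w⟫ = 0 := by
  rw [rawPartner, inner_smul_left, inner_crossVec_right, mul_zero]

/-- The raw partner is orthogonal to the tangent plane. [folklore] -/
theorem inner_rawPartner_ambientDeriv (y : M) (w : 𝔼 (n+2+1)) (u : 𝔼 n) :
    ⟪rawPartner o f y w, ambientDeriv (𝓡 n) f y u⟫ = 0 := by
  rw [rawPartner, inner_smul_left]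
  refine mul_eq_zero_of_right _ (inner_crossVec_eq_zero_of_mem_span _ _ _ ?_)
  have hu : u = ∑ j, (refBasis n).repr u j • refBasis n j := ((refBasis n).sum_repr u).symm
  rw [hu, map_sum]
  refine Submodule.sum_mem _ fun j _ => ?_
  rw [map_smul]
  exact Submodule.smul_mem _ _ (Submodule.subset_span ⟨j, rfl⟩)

/-- **The raw partner of a normal vector is a normal vector.** [folklore] -/
theorem rawPartner_mem_norSpace (y : M) (w : 𝔼 (n+2+1)) : rawPartner o f y w ∈ norSpace n f y :=
  mem_norSpace_iff.2 ⟨inner_rawPartner_coe y w, fun u => inner_rawPartner_ambientDeriv y w u⟩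

/-- The partner is a normal vector. [folklore] -/
theorem partner_mem_norSpace (y : M) (w : 𝔼 (n+2+1)) : partner o f y w ∈ norSpace n f y :=
  Submodule.smul_mem _ _ (rawPartner_mem_norSpace y w)

/-- `Q_y (J_y w) = J_y w`. [folklore] -/
theorem norProj_partner (y : M) (w : 𝔼 (n+2+1)) : norProj n f y (partner o f y w) = partner o f y w :=
  Submodule.starProjection_eq_self_iff.2 (partner_mem_norSpace y w)

/-- The partner is orthogonal to `w`. [folklore] -/
theorem inner_partner_self (y : M) (w : 𝔼 (n+2+1)) : ⟪partner o f y w, w⟫ = 0 := by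
  rw [partner, inner_smul_left, inner_rawPartner_self, mul_zero]

/-- The partner is orthogonal to `f y`. [folklore] -/
theorem inner_partner_coe (y : M) (w : 𝔼 (n+2+1)) : ⟪partner o f y w, (f y : 𝔼 (n+2+1))⟫ = 0 := by
  rw [partner, inner_smul_left, inner_rawPartner_coe, mul_zero]

section Nonvanishing

variable (hf : ContMDiff (𝓡 n) (𝓡 (n + 2)) ∞ f)
include hf

omit [IsManifold (𝓡 n) ∞ M] in
/-- **Linear independence of the cross data of a nonzero normal vector**: for an immersion,
`f y`, the images of a basis under `d(ι ∘ f)_y` (through any injective `L` with the same range) and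
`w ∈ ν_y ∖ 0` are linearly independent. [folklore] -/
theorem linearIndependent_crossFam_of_mem_norSpace {y : M} {L : 𝔼 n →L[ℝ] 𝔼 (n+2+1)}
    (hL : Injective L)
    (hrange : LinearMap.range (L : 𝔼 n →ₗ[ℝ] 𝔼 (n+2+1)) = tangentPlane (𝓡 n) (sphCoe f) y)
    (b : Basis (Fin n) ℝ (𝔼 n)) {w : 𝔼 (n+2+1)} (hw : w ∈ norSpace n f y) (hw0 : w ≠ 0) :
    LinearIndependent ℝ (crossFam (f y : 𝔼 (n+2+1)) (fun j => L (b j)) w) := by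
  have ha1 : ‖(f y : 𝔼 (n+2+1))‖ = 1 := norm_eq_of_mem_sphere (f y)
  obtain ⟨hwa, hwT⟩ := mem_norSpace_iff.1 hw
  -- the span of the middle vectors is the tangent plane
  have hspan : Submodule.span ℝ (Set.range fun j => L (b j)) = tangentPlane (𝓡 n) (sphCoe f) y := by
    rw [← hrange]
    refine le_antisymm (Submodule.span_le.2 ?_) ?_
    · rintro _ ⟨j, rfl⟩
      exact ⟨b j, rfl⟩
    · rintro _ ⟨u, rfl⟩
      rw [ContinuousLinearMap.coe_coe, ← b.sum_repr u, map_sum]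
      exact Submodule.sum_mem _ fun j _ => by
        rw [map_smul]; exact Submodule.smul_mem _ _ (Submodule.subset_span ⟨j, rfl⟩)
  have hwperp : ∀ t ∈ tangentPlane (𝓡 n) (sphCoe f) y, ⟪w, t⟫ = 0 := by
    rintro t ⟨u, rfl⟩
    exact hwT u
  have haperp : ∀ t ∈ tangentPlane (𝓡 n) (sphCoe f) y, ⟪(f y : 𝔼 (n+2+1)), t⟫ = 0 := by
    rintro t ⟨u, rfl⟩
    exact inner_coe_ambientDeriv hf y u
  rw [crossFam, linearIndependent_finCons]
  constructor
  · rw [linearIndependent_finSnoc]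
    constructor
    · exact (b.linearIndependent.map' (L : 𝔼 n →ₗ[ℝ] 𝔼 (n+2+1)) (LinearMap.ker_eq_bot.2 hL))
    · intro hmem
      rw [hspan] at hmem
      have : ⟪w, w⟫ = 0 := hwperp w hmem
      exact hw0 (inner_self_eq_zero.1 this)
  · intro hmem
    rw [Fin.range_snoc, Submodule.span_insert, hspan] at hmem
    obtain ⟨c, hc, t, ht, hsum⟩ := Submodule.mem_sup.1 hmem
    obtain ⟨r, rfl⟩ := Submodule.mem_span_singleton.1 hc
    have h1 : ⟪(f y : 𝔼 (n+2+1)), (f y : 𝔼 (n+2+1))⟫ = 1 := by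
      rw [real_inner_self_eq_norm_sq, ha1, one_pow]
    have h2 : ⟪(f y : 𝔼 (n+2+1)), r • w + t⟫ = 0 := by
      rw [inner_add_right, inner_smul_right, real_inner_comm, hwa, haperp t ht, mul_zero, add_zero]
    rw [hsum, h1] at h2
    exact one_ne_zero h2

/-- **The raw partner of a nonzero normal vector is nonzero.** [cite: Kirby1989, Ch. VIII, proof of Thm. 2, p. 44] -/
theorem rawPartner_ne_zero {y : M} (hf' : Injective (mfderiv (𝓡 n) (𝓡 (n + 2)) f y)) {w : 𝔼 (n+2+1)}
    (hw : w ∈ norSpace n f y) (hw0 : w ≠ 0) : rawPartner o f y w ≠ 0 := by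
  rw [rawPartner]
  refine smul_ne_zero (o.sign_ne_zero y) (crossVec_ne_zero ?_)
  exact linearIndependent_crossFam_of_mem_norSpace hf (injective_ambientDeriv hf hf') rfl
    (refBasis n) hw hw0

/-- **The partner of a nonzero normal vector is a unit vector.** [folklore] -/
theorem norm_partner {y : M} (hf' : Injective (mfderiv (𝓡 n) (𝓡 (n + 2)) f y)) {w : 𝔼 (n+2+1)}
    (hw : w ∈ norSpace n f y) (hw0 : w ≠ 0) : ‖partner o f y w‖ = 1 := by
  have h := norm_ne_zero_iff.2 (rawPartner_ne_zero (o := o) hf hf' hw hw0)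
  rw [partner, norm_smul, norm_inv, norm_norm, inv_mul_cancel₀ h]

/-- The partner of a nonzero normal vector is nonzero. [folklore] -/
theorem partner_ne_zero {y : M} (hf' : Injective (mfderiv (𝓡 n) (𝓡 (n + 2)) f y)) {w : 𝔼 (n+2+1)}
    (hw : w ∈ norSpace n f y) (hw0 : w ≠ 0) : partner o f y w ≠ 0 := by
  rw [← norm_ne_zero_iff, norm_partner hf hf' hw hw0]
  exact one_ne_zero

end Nonvanishing

/-! #### The local representation in a chart -/

section Local

variable (f) in
/-- The **local cross field** at the base point `x₀`: the cross vector of `f y`, the chart frame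
`D(ι ∘ f ∘ φ⁻¹)(φ y) ∘ b` of the tangent plane (`φ` the chart at `x₀`, `b` the reference basis)
and `w` — a continuous function of `(y, w)` on the chart domain. [folklore] -/
def localCross (x₀ y : M) (w : 𝔼 (n+2+1)) : 𝔼 (n+2+1) :=
  crossVec (f y : 𝔼 (n+2+1))
    (fun j => chartDeriv (𝓡 n) (sphCoe f) x₀ (extChartAt (𝓡 n) x₀ y) (refBasis n j)) w

/-- The chart at `x₀` belongs to the `C^∞` maximal atlas. [folklore] -/
theorem chartAt_mem_maximalAtlas (x₀ : M) :
    chartAt (𝔼 n) x₀ ∈ IsManifold.maximalAtlas 𝓘(ℝ, 𝔼 n) ∞ M :=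
  IsManifold.chart_mem_maximalAtlas x₀

variable (hf : ContMDiff (𝓡 n) (𝓡 (n + 2)) ∞ f)
include hf

/-- **The global frame through the chart frame**: on the chart domain of `x₀`,
`d(ι ∘ f)_y (b j) = D(ι∘f∘φ⁻¹)(φ y) (dφ_y (b j))`. [folklore] -/
theorem ambientDeriv_refBasis_eq (x₀ : M) {y : M} (hy : y ∈ (chartAt (𝔼 n) x₀).source) (j : Fin n) :
    ambientDeriv (𝓡 n) f y (refBasis n j) =
      chartDeriv (𝓡 n) (sphCoe f) x₀ (extChartAt (𝓡 n) x₀ y)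
        (readFrame (chartAt (𝔼 n) x₀) y (refBasis n) j) := by
  have hy' : y ∈ (extChartAt (𝓡 n) x₀).source := by rwa [extChartAt_source]
  have h := mfderiv_eq_chartDeriv_comp (I := 𝓡 n) (e := sphCoe f) hy'
    ((contMDiff_sphCoe hf y).mdifferentiableAt (by simp))
  have h2 := DFunLike.congr_fun h (refBasis n j)
  exact h2

/-- **Local representation of the raw partner**: on the chart domain of `x₀`,
`rawPartner o f y w = (sign o y · det_b (dφ_y ∘ b)) • localCross f x₀ y w`. [folklore] -/
theorem rawPartner_eq_smul_localCross (x₀ : M) {y : M} (hy : y ∈ (chartAt (𝔼 n) x₀).source)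
    (w : 𝔼 (n+2+1)) :
    rawPartner o f y w = (o.sign y * (refBasis n).det (readFrame (chartAt (𝔼 n) x₀) y (refBasis n))) •
      localCross f x₀ y w := by
  rw [rawPartner, localCross, mul_smul]
  congr 1
  have hframe : (fun j => ambientDeriv (𝓡 n) f y (refBasis n j)) = fun j =>
      chartDeriv (𝓡 n) (sphCoe f) x₀ (extChartAt (𝓡 n) x₀ y)
        (readFrame (chartAt (𝔼 n) x₀) y (refBasis n) j) :=
    funext fun j => ambientDeriv_refBasis_eq hf x₀ hy j
  rw [hframe]
  exact crossVec_eq_det_smul _ _ _ (refBasis n) _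

omit hf in
/-- The scalar of the local representation is nonzero. [folklore] -/
theorem sign_mul_det_readFrame_ne_zero (x₀ : M) {y : M} (hy : y ∈ (chartAt (𝔼 n) x₀).source) :
    o.sign y * (refBasis n).det (readFrame (chartAt (𝔼 n) x₀) y (refBasis n)) ≠ 0 := by
  refine mul_ne_zero (o.sign_ne_zero y) ?_
  rw [refBasis_det]
  have : (readFrame (chartAt (𝔼 n) x₀) y (refBasis n) ∘
      ⇑(finCongr (finrank_euclideanSpace_fin (𝕜 := ℝ) (n := n)))) =
        readFrame (chartAt (𝔼 n) x₀) y (finBasis ℝ (𝔼 n)) := by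
    funext i
    simp only [Function.comp_apply, readFrame_apply]
    rw [← refBasis_comp n]
    rfl
  rw [this]
  have h2 : (finBasis ℝ (𝔼 n)).det (readFrame (chartAt (𝔼 n) x₀) y (finBasis ℝ (𝔼 n))) =
      LinearMap.det (chartDiff (chartAt (𝔼 n) x₀) y : 𝔼 n →ₗ[ℝ] 𝔼 n) := by
    unfold readFrame
    rw [basis_det_clm_apply, Basis.det_self, mul_one]
  rw [h2]
  exact det_chartDiff_ne_zero (chartAt_mem_maximalAtlas x₀) hy

omit hf in
/-- **The sign of the scalar is the orientation character of the chart**: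
`0 < sign o y · det_b (dφ_y ∘ b)` iff the chart at `x₀` is positively oriented at `y`. [folklore] -/
theorem sign_mul_det_readFrame_pos_iff (x₀ : M) {y : M} (hy : y ∈ (chartAt (𝔼 n) x₀).source) :
    0 < o.sign y * (refBasis n).det (readFrame (chartAt (𝔼 n) x₀) y (refBasis n)) ↔
      o.IsPosChart (chartAt (𝔼 n) x₀) y := by
  set d := (finBasis ℝ (𝔼 n)).det (readFrame (chartAt (𝔼 n) x₀) y (finBasis ℝ (𝔼 n))) with hd
  have hdet : (refBasis n).det (readFrame (chartAt (𝔼 n) x₀) y (refBasis n)) = d := by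
    rw [refBasis_det, hd]
    congr 1
    funext i
    simp only [Function.comp_apply, readFrame_apply]
    rw [← refBasis_comp n]
    rfl
  have hd0 : d ≠ 0 := by
    have h := sign_mul_det_readFrame_ne_zero (o := o) x₀ hy
    rw [hdet] at h
    exact right_ne_zero_of_mul h
  have key : o.IsPosFrame y (finBasis ℝ (𝔼 n)) ↔ (o.IsPosChart (chartAt (𝔼 n) x₀) y ↔ 0 < d) :=
    o.isPosFrame_iff_isPosChart_iff (chartAt_mem_maximalAtlas x₀) hy hd0
  have hpos : o.IsPosFrame y (finBasis ℝ (𝔼 n)) ↔ o.sign y = 1 := by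
    rw [SmoothOrientation.IsPosFrame, Basis.det_self, mul_one]
    constructor
    · intro h
      rcases o.sign_eq_one_or y with h1 | h1
      · exact h1
      · rw [h1] at h; norm_num at h
    · intro h; rw [h]; exact one_pos
  rw [hpos] at key
  rw [hdet]
  rcases o.sign_eq_one_or y with h1 | h1
  · rw [h1, one_mul]
    exact (key.1 h1).symm
  · have hne : o.sign y ≠ 1 := by rw [h1]; norm_num
    have hkey : ¬(o.IsPosChart (chartAt (𝔼 n) x₀) y ↔ 0 < d) := fun h => hne (key.2 h)
    rw [h1, neg_one_mul, neg_pos]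
    constructor
    · intro hdn
      by_contra hP
      exact hkey ⟨fun h => absurd h hP, fun h => absurd hdn (not_lt.2 h.le)⟩
    · intro hP
      rcases lt_or_gt_of_ne hd0 with h | h
      · exact h
      · exact absurd ⟨fun _ => h, fun _ => hP⟩ hkey

/-- **The local cross field is continuous** in `(y, w)` over the chart domain of `x₀`.
[folklore] -/
theorem continuousOn_localCross (x₀ : M) :
    ContinuousOn (fun p : M × 𝔼 (n+2+1) => localCross f x₀ p.1 p.2)
      ((chartAt (𝔼 n) x₀).source ×ˢ univ) := by
  have he := contMDiff_sphCoe hf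
  -- `y ↦ D(ι∘f∘φ⁻¹)(φ y)` is continuous on the chart domain
  have hD : ContinuousOn (fun y => chartDeriv (𝓡 n) (sphCoe f) x₀ (extChartAt (𝓡 n) x₀ y))
      (chartAt (𝔼 n) x₀).source := by
    have h1 : ContinuousOn (chartDeriv (𝓡 n) (sphCoe f) x₀) (extChartAt (𝓡 n) x₀).target :=
      (contDiffOn_chartDeriv he x₀).continuousOn
    have h2 : ContinuousOn (extChartAt (𝓡 n) x₀) (chartAt (𝔼 n) x₀).source := by
      rw [← extChartAt_source (𝓡 n)]; exact continuousOn_extChartAt x₀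
    have h3 : MapsTo (extChartAt (𝓡 n) x₀) (chartAt (𝔼 n) x₀).source (extChartAt (𝓡 n) x₀).target :=
      fun y hy => (extChartAt (𝓡 n) x₀).map_source (by rwa [extChartAt_source])
    exact h1.comp h2 h3
  have hframe : ContinuousOn (fun y => fun j : Fin n =>
      chartDeriv (𝓡 n) (sphCoe f) x₀ (extChartAt (𝓡 n) x₀ y) (refBasis n j)) (chartAt (𝔼 n) x₀).source :=
    continuousOn_pi.2 fun j => hD.clm_apply continuousOn_const
  have hfc : Continuous fun y : M => (f y : 𝔼 (n+2+1)) := he.continuous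
  have hdata : ContinuousOn (fun p : M × 𝔼 (n+2+1) => ((f p.1 : 𝔼 (n+2+1)),
      (fun j : Fin n => chartDeriv (𝓡 n) (sphCoe f) x₀ (extChartAt (𝓡 n) x₀ p.1) (refBasis n j)), p.2))
      ((chartAt (𝔼 n) x₀).source ×ˢ univ) := by
    refine (hfc.comp_continuousOn continuousOn_fst).prodMk ?_
    refine ContinuousOn.prodMk ?_ continuousOn_snd
    exact hframe.comp continuousOn_fst fun p hp => hp.1
  -- (`congr` rather than `exact`: unfolding `localCross` against `vecCross` by unification is slow)
  refine (continuous_crossVec.comp_continuousOn hdata).congr fun p _ => ?_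
  simp only [Function.comp_apply, localCross]

omit [IsManifold (𝓡 n) ∞ M] hf in
/-- Normalising a positive multiple. [folklore] -/
theorem normalize_smul_eq_of_pos {c : ℝ} (hc : 0 < c) (x : 𝔼 (n+2+1)) :
    ‖c • x‖⁻¹ • (c • x) = ‖x‖⁻¹ • x := by
  by_cases hx : x = 0
  · simp [hx]
  · have hxn : ‖x‖ ≠ 0 := norm_ne_zero_iff.2 hx
    have hc0 : c ≠ 0 := hc.ne'
    rw [norm_smul, Real.norm_eq_abs, abs_of_pos hc, smul_smul]
    congr 1
    field_simp

omit [IsManifold (𝓡 n) ∞ M] hf in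
/-- Normalising a negative multiple. [folklore] -/
theorem normalize_smul_eq_of_neg {c : ℝ} (hc : c < 0) (x : 𝔼 (n+2+1)) :
    ‖c • x‖⁻¹ • (c • x) = -(‖x‖⁻¹ • x) := by
  by_cases hx : x = 0
  · simp [hx]
  · have hxn : ‖x‖ ≠ 0 := norm_ne_zero_iff.2 hx
    have hc0 : c ≠ 0 := hc.ne
    rw [norm_smul, Real.norm_eq_abs, abs_of_neg hc, smul_smul, ← neg_smul]
    congr 1
    field_simp

/-- **Local formula for the partner**: on a preconnected part `C` of the chart domain of `x₀`
the partner is `ε · localCross / ‖localCross‖` with one sign `ε = ±1` for all of `C` (`+` iff the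
chart is positively oriented on `C`). [folklore] -/
theorem exists_partner_eq_on_preconnected (x₀ : M) {C : Set M} (hC : IsPreconnected C)
    (hCsrc : C ⊆ (chartAt (𝔼 n) x₀).source) :
    ∃ ε : ℝ, ∀ y ∈ C, ∀ w : 𝔼 (n+2+1),
      partner o f y w = ε • (‖localCross f x₀ y w‖⁻¹ • localCross f x₀ y w) := by
  rcases C.eq_empty_or_nonempty with rfl | ⟨y₁, hy₁⟩
  · exact ⟨1, fun y hy => absurd hy (notMem_empty y)⟩
  have key : ∀ y ∈ C, ∀ w, partner o f y w =
      (‖localCross f x₀ y w‖⁻¹ • localCross f x₀ y w) ∧ o.IsPosChart (chartAt (𝔼 n) x₀) y₁ ∨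
      partner o f y w = -(‖localCross f x₀ y w‖⁻¹ • localCross f x₀ y w) ∧
        ¬o.IsPosChart (chartAt (𝔼 n) x₀) y₁ := by
    intro y hy w
    have hconst : o.IsPosChart (chartAt (𝔼 n) x₀) y ↔ o.IsPosChart (chartAt (𝔼 n) x₀) y₁ :=
      o.isPosChart_iff_of_isPreconnected (chartAt_mem_maximalAtlas x₀) hC hCsrc hy hy₁
    set c := o.sign y * (refBasis n).det (readFrame (chartAt (𝔼 n) x₀) y (refBasis n)) with hc
    have hc0 : c ≠ 0 := sign_mul_det_readFrame_ne_zero x₀ (hCsrc hy)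
    have hcpos : 0 < c ↔ o.IsPosChart (chartAt (𝔼 n) x₀) y :=
      sign_mul_det_readFrame_pos_iff x₀ (hCsrc hy)
    rw [partner, rawPartner_eq_smul_localCross hf x₀ (hCsrc hy), ← hc]
    by_cases hP : o.IsPosChart (chartAt (𝔼 n) x₀) y₁
    · exact Or.inl ⟨normalize_smul_eq_of_pos (hcpos.2 (hconst.2 hP)) _, hP⟩
    · have hneg : c < 0 := lt_of_le_of_ne (not_lt.1 fun h => hP (hconst.1 (hcpos.1 h))) hc0
      exact Or.inr ⟨normalize_smul_eq_of_neg hneg _, hP⟩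
  by_cases hP : o.IsPosChart (chartAt (𝔼 n) x₀) y₁
  · refine ⟨1, fun y hy w => ?_⟩
    rcases key y hy w with ⟨h, -⟩ | ⟨-, h⟩
    · rw [h, one_smul]
    · exact absurd hP h
  · refine ⟨-1, fun y hy w => ?_⟩
    rcases key y hy w with ⟨-, h⟩ | ⟨h, -⟩
    · exact absurd h hP
    · rw [h, neg_one_smul]

/-- **The partner field is continuous on the set of nonzero normal vectors** (jointly in the point
and the vector). [cite: Kirby1989, Ch. VIII, proof of Thm. 2, p. 44] -/
theorem continuousOn_partner (hf' : ∀ x, Injective (mfderiv (𝓡 n) (𝓡 (n + 2)) f x)) :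
    ContinuousOn (fun p : M × 𝔼 (n+2+1) => partner o f p.1 p.2)
      {p | p.2 ∈ norSpace n f p.1 ∧ p.2 ≠ 0} := by
  rintro ⟨x₀, w₀⟩ hp
  set φ := chartAt (𝔼 n) x₀ with hφ
  -- a preconnected open neighbourhood of `x₀` inside the chart domain
  obtain ⟨r, hr, hball⟩ := Metric.isOpen_iff.1 φ.open_target (φ x₀) (φ.map_source (mem_chart_source _ x₀))
  set C : Set M := φ.symm '' Metric.ball (φ x₀) r with hCdef
  have hCsrc : C ⊆ φ.source := by
    rintro _ ⟨q, hq, rfl⟩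
    exact φ.map_target (hball hq)
  have hx₀C : x₀ ∈ C := ⟨φ x₀, Metric.mem_ball_self hr, φ.left_inv (mem_chart_source _ x₀)⟩
  have hCpre : IsPreconnected C :=
    (convex_ball (φ x₀) r).isPreconnected.image _ (φ.continuousOn_symm.mono hball)
  have hCopen : IsOpen C := by
    rw [hCdef]
    exact φ.symm.isOpen_image_of_subset_source Metric.isOpen_ball (by simpa using hball)
  have hCnhds : (C ×ˢ (univ : Set (𝔼 (n+2+1)))) ∈ 𝓝 (x₀, w₀) :=
    prod_mem_nhds (hCopen.mem_nhds hx₀C) univ_mem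
  -- the local formula, continuous where the local cross field does not vanish
  obtain ⟨ε, hε⟩ := exists_partner_eq_on_preconnected (o := o) hf x₀ hCpre hCsrc
  set g : M × 𝔼 (n+2+1) → 𝔼 (n+2+1) := fun p =>
    ε • (‖localCross f x₀ p.1 p.2‖⁻¹ • localCross f x₀ p.1 p.2) with hg
  have hS : ∀ p ∈ {p : M × 𝔼 (n+2+1) | p.2 ∈ norSpace n f p.1 ∧ p.2 ≠ 0} ∩ C ×ˢ univ,
      partner o f p.1 p.2 = g p ∧ localCross f x₀ p.1 p.2 ≠ 0 := by
    rintro ⟨y, w⟩ ⟨⟨hw, hw0⟩, hyC, -⟩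
    refine ⟨hε y hyC w, fun h0 => ?_⟩
    have h := rawPartner_ne_zero (o := o) hf (hf' y) hw hw0
    rw [rawPartner_eq_smul_localCross hf x₀ (hCsrc hyC), h0, smul_zero] at h
    exact h rfl
  have hgc : ContinuousOn g ({p : M × 𝔼 (n+2+1) | p.2 ∈ norSpace n f p.1 ∧ p.2 ≠ 0} ∩ C ×ˢ univ) := by
    have hL := (continuousOn_localCross hf x₀).mono
      (show {p : M × 𝔼 (n+2+1) | p.2 ∈ norSpace n f p.1 ∧ p.2 ≠ 0} ∩ C ×ˢ univ ⊆ φ.source ×ˢ univ from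
        fun p hp => ⟨hCsrc hp.2.1, mem_univ _⟩)
    have hn : ContinuousOn (fun p : M × 𝔼 (n+2+1) => ‖localCross f x₀ p.1 p.2‖⁻¹)
        ({p : M × 𝔼 (n+2+1) | p.2 ∈ norSpace n f p.1 ∧ p.2 ≠ 0} ∩ C ×ˢ univ) :=
      hL.norm.inv₀ fun p hp => norm_ne_zero_iff.2 (hS p hp).2
    exact (hn.smul hL).const_smul ε
  have key : ContinuousWithinAt (fun p : M × 𝔼 (n+2+1) => partner o f p.1 p.2)
      ({p : M × 𝔼 (n+2+1) | p.2 ∈ norSpace n f p.1 ∧ p.2 ≠ 0} ∩ C ×ˢ univ) (x₀, w₀) :=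
    (hgc.congr fun p hp => (hS p hp).1) (x₀, w₀) ⟨hp, hx₀C, mem_univ _⟩
  exact (continuousWithinAt_inter hCnhds).1 key

end Local

end Partner

end Literature.Topology.FourManifolds
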